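import Literature.AlgebraicTopology.SingularHomology.EilenbergDeformationChains
import Literature.AlgebraicTopology.SingularHomology.HurewiczDevice
import Literature.AlgebraicTopology.SingularHomology.HurewiczTheorem
import Literature.AlgebraicTopology.SingularHomology.HomotopyAdditionProofs
import Mathlib.Algebra.Group.Equiv.TypeTags
import HarnessLib

/-!
# The Hurewicz isomorphism theorem via Eilenberg subcomplexes (Spanier §7.4–§7.5): assembly

Topic `Literature/AlgebraicTopology/SingularHomology`. The absolute Hurewicz theorem — Hatcher,
*Algebraic Topology* (2002), Thm. 4.32: "If a space `X` is `(n-1)`-connected, `n ≥ 2`, then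
`H̃ᵢ(X) = 0` for `i < n` and `πₙ(X) ≈ Hₙ(X)`" — is vendored in `HurewiczTheorem.lean` as the named
facts `hurewicz_isZero` (discharged in `HurewiczTheoremProofs.lean`) and `hurewicz_iso`. Hatcher's
printed proof (CW approximation 4.13/4.15, cellular homology, homotopy excision 4.23/4.28) rests on
theories absent from Mathlib and `Literature/`. E. H. Spanier, *Algebraic Topology* (Springer
1981), Ch. 7 §4–§5 proves the theorem inside singular theory, through the Eilenberg subcomplexes
`Δ(X, A, x₀)ⁿ` (`EilenbergSubcomplex.lean`) and the classes `[σ] ∈ πₙ(X, x₀)` of their simplices,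
in three steps — (1) Thm. 7.4.8 / Cor. 7.4.9, the inclusion `Δ(X, {x₀}, x₀)ⁿ⁻¹ ⊂ Δ(X)` is a chain
equivalence for `(n-1)`-connected `X` (PROVED: `isIso_homologyMap_eilenbergSub_ι`,
`EilenbergDeformationChains.lean`); (2) Prop. 7.5.3, the homotopy addition theorem; (3) §7.5
(d)–(e), `Hₙ(Δ(X, {x₀}, x₀)ⁿ⁻¹) ≅ πₙ(X, x₀)` from (2) (PROVED for every Hurewicz device:
`HurewiczDevice.Device.exists_addEquiv`, `HurewiczDevice.lean`). This file assembles them: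

* `hurewicz_iso_of_addEquiv` — `hurewicz_iso` from Step 3 in its weakest form, the mere existence
  of additive isomorphisms `H_(m+2)(Δ(X, {x₀}, x₀)ᵐ⁺¹) ≃+ π_(m+2)(X, x₀)`: for `X` simply connected
  with `π_k(X) = 0` for `2 ≤ k < n = m + 2` and any base point `x`,
  `Hₙ(X; ℤ) ≅ Hₙ(C^conc(X; ℤ))` (`csingularHomology.compIso`) `≅ Hₙ(Δ(X, {x}, x)ⁿ⁻¹)` (Step 1 with
  `k = n - 1`: `π₁ = 0` by simple connectivity, `π_q = 0` for `2 ≤ q ≤ n - 1` by hypothesis)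
  `≅ πₙ(X, x)`;
* `hurewicz_iso_of_device` — **`hurewicz_iso` from Hurewicz devices** in all degrees `≥ 2` at all
  points (Step 3 for a device);
* `CubeCollapse.homotopicRel_of_comp_collapse` — homotopies rel `∂Iⁿ` of loops `g ∘ κₙ`, `g' ∘ κₙ`
  descend along the collapse `κₙ : Iⁿ → Δⁿ` (`CubeSimplexCollapse.lean`; `1 × κₙ` is a quotient
  map) to homotopies `g ≃ g'` rel `∂Δⁿ`; hence the device `collapseClass g = [g ∘ κₙ]` of
  `HomotopyAdditionProofs.lean` — whose homotopy addition nullity is PROVED there from the cubical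
  homotopy addition theorem — is faithful on homotopy classes: `collapseDevice`;
* `hurewicz_iso_of_collapseDevice : hurewicz_iso` — **Hatcher's Theorem 4.32 (isomorphism clause),
  i.e. the named fact `hurewicz_iso` of `HurewiczTheorem.lean`, PROVED** (its one-line discharge
  belongs next to `hurewicz_isZero_holds` in the sibling proofs file of `HurewiczTheorem.lean`).

## References

* E. H. Spanier, *Algebraic Topology*, Springer 1981 (orig. McGraw-Hill 1966), Ch. 7 §4
  (pp. 390–393: `Δ(X, A, x₀)ⁿ`, Lemma 7, Thm. 8, Cor. 9) and §5 (pp. 393–398: Props. 1–3,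
  steps (a)–(e), Thms. 4, 5); held copy PDF pp. 433–441. [Spanier1981]
* A. Hatcher, *Algebraic Topology*, CUP 2002, §4.2 Thm. 4.32 (p. 366). [HatcherAT2002]
* S. Eilenberg, *Singular homology theory*, Ann. of Math. (2) 45 (1944), 407–447, §31–§32
  (the original source of both the subcomplexes and this proof; cited through Spanier).
-/

noncomputable section

open CategoryTheory Function Topology
open scoped unitInterval Topology.Homotopy

universe u

namespace Literature.AlgebraicTopology.SingularHomology

open SingularSimplex eilenbergSimplices

/-- **Spanier Cor. 7.4.9 + §7.5 (e) ⇒ Hatcher Thm. 4.32 (isomorphism clause).** If for every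
space, point and `m` the degree-`(m+2)` homology of the Eilenberg subcomplex `Δ(X, {x₀}, x₀)ᵐ⁺¹`
is additively isomorphic to `π_(m+2)(X, x₀)`, then `hurewicz_iso` holds: for `X` simply connected
with `π_k(X) = 0` for `2 ≤ k < n`, `n ≥ 2`, `Hₙ(X; ℤ) ≅ Hₙ(Δ(X, {x}, x)ⁿ⁻¹)`
(`isIso_homologyMap_eilenbergSub_ι`, `csingularHomology.compIso`) `≅ πₙ(X, x)`. PROVED.
[cite: Spanier1981, Thm. 7.5.5] [cite: HatcherAT2002, Thm. 4.32] -/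
theorem hurewicz_iso_of_addEquiv
    (h3 : ∀ (X : Type u) [TopologicalSpace X] (x₀ : X) (m : ℕ),
      Nonempty ((eilenbergSub ℤ ℤ X x₀ (m + 1)).toComplex.homology (m + 2) ≃+ Additive (π_ (m + 2) X x₀))) :
    hurewicz_iso.{u} := by
  intro X _ _ n _ hn hπ x
  obtain ⟨m, rfl⟩ : ∃ m, n = m + 2 := ⟨n - 2, by omega⟩
  -- Step 1: the quasi-isomorphism `Δ(X, {x}, x)^{m+1} ⊂ C(X)` for the `(m+1)`-connected `X`.
  have hconn : ∀ q : ℕ, 1 ≤ q → q ≤ m + 1 → ∀ y : X, Subsingleton (π_ q X y) := by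
    intro q h1q hq y
    rcases Nat.lt_or_ge q 2 with hq2 | hq2
    · obtain rfl : q = 1 := by omega
      exact (HomotopyGroup.pi1EquivFundamentalGroup : π_ 1 X y ≃ FundamentalGroup X y).subsingleton
    · exact hπ q hq2 (by omega) y
  haveI := isIso_homologyMap_eilenbergSub_ι x (m + 1) hconn ℤ (m + 2)
  -- Step 3: `H_{m+2}(Δ(X, {x}, x)^{m+1}) ≃+ π_{m+2}(X, x)`.
  obtain ⟨e3⟩ := h3 X x m
  -- homology of the subcomplex ≅ homology of the concrete complex ≅ Mathlib's singular homology
  let i1 : (eilenbergSub ℤ ℤ X x (m + 1)).toComplex.homology (m + 2) ≅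
      (csingularChainComplex ℤ ℤ X).homology (m + 2) :=
    asIso (HomologicalComplex.homologyMap (eilenbergSub ℤ ℤ X x (m + 1)).ι (m + 2))
  let i2 : (csingularChainComplex ℤ ℤ X).homology (m + 2) ≅ singularHomology ℤ ℤ X (m + 2) :=
    csingularHomology.compIso ℤ ℤ X (m + 2)
  let eH : (singularHomology ℤ ℤ X (m + 2)) ≃+
      (eilenbergSub ℤ ℤ X x (m + 1)).toComplex.homology (m + 2) :=
    ((i1 ≪≫ i2).toLinearEquiv.toAddEquiv).symm
  exact ⟨AddEquiv.toMultiplicativeRight (e3.symm.trans eH.symm)⟩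

/-- **Hurewicz's theorem from Hurewicz devices** (Spanier Thm. 7.5.5 ⇒ Hatcher Thm. 4.32): if every
space carries, at every point and in every degree `m + 2`, a Hurewicz device (classes of simplices
`(Δᵐ⁺², ∂Δᵐ⁺²) → (X, x₀)` with the homotopy addition nullity, `HurewiczDevice.Device`), then
`hurewicz_iso` holds. PROVED. [cite: Spanier1981, Thm. 7.5.5] [cite: HatcherAT2002, Thm. 4.32] -/
theorem hurewicz_iso_of_device
    (D : ∀ (X : Type u) [TopologicalSpace X] (x₀ : X) (m : ℕ), HurewiczDevice.Device X x₀ m) :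
    hurewicz_iso.{u} :=
  hurewicz_iso_of_addEquiv fun X _ x₀ m => let ⟨e, _⟩ := (D X x₀ m).exists_addEquiv; ⟨e⟩

/-! ### The device `collapseClass` is faithful on homotopy classes -/

namespace CubeCollapse

variable {n : ℕ} {X : Type u} [TopologicalSpace X]

variable (n) in
/-- `1 × κₙ : I × Iⁿ → I × Δⁿ` as a continuous map. [folklore] -/
def prodCollapse : C(I × (Fin n → I), I × StdSimplex n) :=
  ⟨Prod.map id collapse, continuous_id.prodMap continuous_collapse⟩

/-- `1 × κₙ` pointwise. [folklore] -/
@[simp] lemma prodCollapse_apply (t : I) (y : Fin n → I) : prodCollapse n (t, y) = (t, collapse y) := rfl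

/-- `1 × κₙ : I × Iⁿ → I × Δⁿ` is a quotient map (a continuous closed surjection from a compact
space to a Hausdorff space). [folklore] -/
theorem isQuotientMap_prodCollapse : IsQuotientMap (prodCollapse n) :=
  (prodCollapse n).continuous.isClosedMap.isQuotientMap (prodCollapse n).continuous
    (surjective_id.prodMap collapse_surjective)

/-- Points of the cube with the same collapse are equal or both on the boundary. [folklore] -/
lemma eq_or_mem_boundary_of_collapse_eq {y y' : Fin n → I} (h : collapse y = collapse y') :
    y = y' ∨ (y ∈ Cube.boundary (Fin n) ∧ y' ∈ Cube.boundary (Fin n)) := by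
  by_cases hy : y ∈ Cube.boundary (Fin n)
  · refine Or.inr ⟨hy, ?_⟩
    by_contra hy'
    exact collapse_not_mem_stdBoundary hy' (h ▸ collapse_mem_stdBoundary hy)
  · exact Or.inl (eq_of_collapse_eq h hy)

/-- **Homotopies rel `∂Iⁿ` descend along the collapse.** If `p = g ∘ κₙ` and `p' = g' ∘ κₙ` are
homotopic rel `∂Iⁿ`, then `g` and `g'` are homotopic rel `∂Δⁿ`: the homotopy is constant on the
fibres of `1 × κₙ` (points over `∂Δⁿ` come from `∂Iⁿ`, where the homotopy is `p = g ∘ κₙ`), so it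
factors through the quotient map `1 × κₙ`. [folklore] -/
theorem homotopicRel_of_comp_collapse {p p' : C((Fin n → I), X)} {g g' : C(StdSimplex n, X)}
    (hp : ∀ y, p y = g (collapse y)) (hp' : ∀ y, p' y = g' (collapse y))
    (h : p.HomotopicRel p' (Cube.boundary (Fin n))) : g.HomotopicRel g' (stdBoundary n) := by
  obtain ⟨H⟩ := h
  -- the homotopy is constant on the fibres of `1 × κ`
  have hfac : Function.FactorsThrough (H : C(I × (Fin n → I), X)) (prodCollapse n) := by
    rintro ⟨t, y⟩ ⟨t', y'⟩ he
    simp only [prodCollapse_apply, Prod.mk.injEq] at he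
    obtain ⟨rfl, hyy⟩ := he
    rcases eq_or_mem_boundary_of_collapse_eq hyy with rfl | ⟨hy, hy'⟩
    · rfl
    · change H (t, y) = H (t, y')
      rw [H.eq_fst t hy, H.eq_fst t hy', hp, hp, hyy]
  let H' : C(I × StdSimplex n, X) := isQuotientMap_prodCollapse.lift (H : C(I × (Fin n → I), X)) hfac
  have hH' : ∀ (t : I) (y : Fin n → I), H' (t, collapse y) = H (t, y) := fun t y => by
    have := ContinuousMap.congr_fun
      (isQuotientMap_prodCollapse.lift_comp (H : C(I × (Fin n → I), X)) hfac) (t, y)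
    rw [ContinuousMap.comp_apply, prodCollapse_apply] at this
    exact this
  refine ⟨{ toFun := fun q => H' q
            continuous_toFun := H'.continuous
            map_zero_left := fun z => ?_
            map_one_left := fun z => ?_
            prop' := fun t z hz => ?_ }⟩
  · obtain ⟨y, rfl⟩ := collapse_surjective z
    change H' (0, collapse y) = g (collapse y)
    rw [hH', H.apply_zero, hp]
  · obtain ⟨y, rfl⟩ := collapse_surjective z
    change H' (1, collapse y) = g' (collapse y)
    rw [hH', H.apply_one, hp']
  · obtain ⟨y, rfl⟩ := collapse_surjective z
    have hy : y ∈ Cube.boundary (Fin n) := by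
      by_contra hy; exact collapse_not_mem_stdBoundary hy hz
    change H' (t, collapse y) = g (collapse y)
    rw [hH', H.eq_fst t hy, hp]

end CubeCollapse

/-- **Equal collapse classes come from maps homotopic rel `∂Δⁿ`**: `[g ∘ κₙ] = [g' ∘ κₙ]` in
`πₙ(X, x₀)` means `g ∘ κₙ ≃ g' ∘ κₙ rel ∂Iⁿ`, which descends along the collapse. [folklore] -/
theorem homotopicRel_of_collapseClass_eq {X : Type u} [TopologicalSpace X] {x₀ : X} {n : ℕ}
    {g g' : C(StdSimplex n, X)} (hg : ∀ t ∈ stdBoundary n, g t = x₀)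
    (hg' : ∀ t ∈ stdBoundary n, g' t = x₀) (h : collapseClass g hg = collapseClass g' hg') :
    g.HomotopicRel g' (stdBoundary n) := by
  have h' : (collapseLoop g hg : C((Fin n → I), X)).HomotopicRel (collapseLoop g' hg' : C((Fin n → I), X))
      (Cube.boundary (Fin n)) :=
    Quotient.exact h
  exact CubeCollapse.homotopicRel_of_comp_collapse (fun _ => rfl) (fun _ => rfl) h'

/-- **The Hurewicz device `collapseClass`**: the homotopy addition data of
`HomotopyAdditionProofs.lean` (`g ↦ [g ∘ κₙ]`, nullity from the cubical homotopy addition theorem)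
are faithful on homotopy classes. [cite: Spanier1981, Ch. 7 §5 pp. 391–397] -/
def collapseDevice (X : Type u) [TopologicalSpace X] (x₀ : X) (m : ℕ) : HurewiczDevice.Device X x₀ m :=
  { collapseHomotopyAdditionData X x₀ m with
    homotopicRel_of_cls_eq := fun hg hg' h => homotopicRel_of_collapseClass_eq hg hg' h }

/-- **The Hurewicz isomorphism theorem** (Hatcher, *Algebraic Topology* (2002), Thm. 4.32,
isomorphism clause; Spanier Thm. 7.5.5): for `X` simply connected with `π_k(X) = 0` for
`2 ≤ k < n`, `n ≥ 2`, `πₙ(X, x) ≅ Hₙ(X; ℤ)` at every point — the named fact `hurewicz_iso`, PROVED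
by Spanier's Eilenberg-subcomplex argument (Steps 1–3 above) with the device `collapseClass`.
[cite: HatcherAT2002, Thm. 4.32] [cite: Spanier1981, Thm. 7.5.5] -/
theorem hurewicz_iso_of_collapseDevice : hurewicz_iso.{u} :=
  hurewicz_iso_of_device fun X _ x₀ m => collapseDevice X x₀ m

end Literature.AlgebraicTopology.SingularHomology

end
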